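import Literature.Geometry.Lorentzian.InverseMeanCurvatureFlowMinimizers
import HarnessLib

/-!
# Inverse mean curvature flow I — proofs: the calibrated gap estimate of the Uniqueness Theorem

Sorry-free continuation of `InverseMeanCurvatureFlowMinimizers.lean`: the analytic core of the
proof of Huisken–Ilmanen's Uniqueness Theorem 2.2 (i) (J. Differential Geom. 59 (2001), pp.
23–24 of the printed paper, (2.2)–(2.4) and the calibration step). Everything is proved; no
definitions, no named facts.

* `gradNorm_le_of_mvfderiv_eq` — if `dw_x = a dU_x + b dv_x` then `|∇w|(x) ≤ |a||∇U|(x) + |b||∇v|(x)`;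
  `gradNorm_add_sq_div_two_le` — for `w = U + (v - U)²/2` near `x` and `0 ≤ v x - U x ≤ 1`,
  `|∇w|(x) ≤ (1 - r)|∇U|(x) + r|∇v|(x)`, `r = v x - U x` (chain rule).
* `ae_gradNorm_eq_zero_of_strictSupersolution` — **the gap estimate**: if `U` satisfies the strict
  supersolution inequality (2.2) with constant `ε ∈ (0, 1]` on an open `Ω`, `v` is a weak
  subsolution on `Ω`, `{v > U} ∩ Ω ⊂⊂ Ω` and `v ≤ U + ε`, then `|∇U| = 0` and `|∇v| = 0` a.e. on
  `{v > U} ∩ Ω`. The proof transcribes (2.2)–(2.4); Huisken–Ilmanen's calibration — inserting the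
  family `u + (v - s - u)₊`, `s ≥ 0`, and integrating over `s` — is replaced by the *single*
  competitor `U + (v - U)₊²/2 = ∫₀^∞ (u + (v - s - u)₊ - u) ds + u`, which yields the integrated
  inequality `∫ (v-u)₊ (|∇u| - |∇v|) ≤ ∫ ½(v-u)₊² |∇u|` directly (the triangle inequality for the slope
  of `(1 - r) dU + r dv` plays the role of Fubini's theorem).

## References

* G. Huisken, T. Ilmanen, *The inverse mean curvature flow and the Riemannian Penrose
  inequality*, J. Differential Geom. 59 (2001) 353–437: proof of Thm. 2.2 (i), (2.2)–(2.4).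
-/

noncomputable section

open Bundle Set Manifold TopologicalSpace Filter MeasureTheory Function
open scoped ContDiff Topology ENNReal NNReal Manifold Real

namespace Literature.Geometry.Lorentzian

open PseudoRiemannianMetric

variable {X : Type*} [TopologicalSpace X] [ChartedSpace E3 X] [IsManifold (𝓡 3) ∞ X]

/-! ### Slope of a combination of differentials -/

section Slope

variable (h : ContMDiffRiemannianMetric (𝓡 3) ∞ E3 (TangentSpace (𝓡 3) : X → Type _))

set_option backward.isDefEq.respectTransparency false in
/-- **Slope of a linear combination of differentials.** If `dw_x = a dU_x + b dv_x` (pointwise, for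
the `ℝ`-valued differentials `mvfderiv`) then `|∇w|(x) ≤ |a| |∇U|(x) + |b| |∇v|(x)`
(`|∇u|(x) = ‖♯du_x‖_x`, `♯` linear). This is the pointwise convexity step
`|∇(U + ψ(v - U))| ≤ (1 - ψ') |∇U| + ψ' |∇v|` of the calibration argument in Huisken–Ilmanen's
proof of Thm. 2.2 (i). [folklore] -/
theorem gradNorm_le_of_mvfderiv_eq {w U v : X → ℝ} {x : X} (a b : ℝ)
    (hw : ∀ z, mvfderiv (𝓡 3) w x z = a * mvfderiv (𝓡 3) U x z + b * mvfderiv (𝓡 3) v x z) :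
    gradNorm h w x ≤ |a| * gradNorm h U x + |b| * gradNorm h v x := by
  letI : RiemannianBundle (fun x : X ↦ TangentSpace (𝓡 3) x) :=
    ⟨h.toContinuousRiemannianMetric.toRiemannianMetric⟩
  have key : ∀ α : Module.Dual ℝ (TangentSpace (𝓡 3) x),
      Real.sqrt ((ofRiemannian h).innerDual x α α) = ‖(ofRiemannian h).sharp x α‖ := by
    intro α
    rw [← Real.sqrt_sq (norm_nonneg _), ← real_inner_self_eq_norm_sq]
    congr 1
    change α ((ofRiemannian h).sharp x α) = h.inner x _ _
    rw [← val_ofRiemannian, val_sharp_apply]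
  unfold gradNorm
  set αw : Module.Dual ℝ (TangentSpace (𝓡 3) x) := (mfderiv (𝓡 3) 𝓘(ℝ, ℝ) w x).toLinearMap
    with hαw
  set αU : Module.Dual ℝ (TangentSpace (𝓡 3) x) := (mfderiv (𝓡 3) 𝓘(ℝ, ℝ) U x).toLinearMap
    with hαU
  set αv : Module.Dual ℝ (TangentSpace (𝓡 3) x) := (mfderiv (𝓡 3) 𝓘(ℝ, ℝ) v x).toLinearMap
    with hαv
  have hlin : αw = a • αU + b • αv := by
    apply LinearMap.ext
    intro z
    have hz := hw z
    simp only [mvfderiv_apply_eq_mfderiv] at hz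
    simp only [LinearMap.add_apply, LinearMap.smul_apply, smul_eq_mul]
    exact hz
  rw [key, key, key, hlin, map_add, map_smul, map_smul]
  calc ‖a • (ofRiemannian h).sharp x αU + b • (ofRiemannian h).sharp x αv‖
      ≤ ‖a • (ofRiemannian h).sharp x αU‖ + ‖b • (ofRiemannian h).sharp x αv‖ := norm_add_le _ _
    _ = |a| * ‖(ofRiemannian h).sharp x αU‖ + |b| * ‖(ofRiemannian h).sharp x αv‖ := by
        rw [norm_smul, norm_smul, Real.norm_eq_abs, Real.norm_eq_abs]

set_option backward.isDefEq.respectTransparency false in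
/-- **Slope of the calibrated competitor.** For `U, v` differentiable at `x` and
`w = U + (v - U)²/2` near `x`, `dw_x = (1 - r) dU_x + r dv_x` with `r = v x - U x`, hence, when
`0 ≤ r ≤ 1`, `|∇w|(x) ≤ (1 - r) |∇U|(x) + r |∇v|(x)`. [folklore] -/
theorem gradNorm_add_sq_div_two_le {U v w : X → ℝ} {x : X}
    (hU : MDifferentiableAt (𝓡 3) 𝓘(ℝ, ℝ) U x) (hv : MDifferentiableAt (𝓡 3) 𝓘(ℝ, ℝ) v x)
    (hw : w =ᶠ[𝓝 x] fun y ↦ U y + (v y - U y) ^ 2 / 2)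
    (h0 : 0 ≤ v x - U x) (h1 : v x - U x ≤ 1) :
    gradNorm h w x ≤ (1 - (v x - U x)) * gradNorm h U x + (v x - U x) * gradNorm h v x := by
  rw [gradNorm_congr_of_eventuallyEq h hw]
  -- `d(ρ ↦ ρ²/2) = ρ`
  have hG : HasDerivAt (fun ρ : ℝ ↦ ρ ^ 2 / 2) (v x - U x) (v x - U x) := by
    refine ((hasDerivAt_pow 2 (v x - U x)).div_const 2).congr_deriv ?_
    norm_num
  -- `d((v - U)²/2)_x = (v x - U x) d(v - U)_x` (chain rule) and `d(U + (v - U)²/2)_x`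
  have hcomp : HasMFDerivAt (𝓡 3) 𝓘(ℝ, ℝ) ((fun ρ : ℝ ↦ ρ ^ 2 / 2) ∘ (v - U)) x
      ((v x - U x) • (by exact mfderiv (𝓡 3) 𝓘(ℝ, ℝ) (v - U) x) :
        TangentSpace (𝓡 3) x →L[ℝ] ℝ) := by
    have h2 : HasMFDerivAt 𝓘(ℝ, ℝ) 𝓘(ℝ, ℝ) (fun ρ : ℝ ↦ ρ ^ 2 / 2) ((v - U) x)
        (ContinuousLinearMap.smulRight (1 : ℝ →L[ℝ] ℝ) (v x - U x)) :=
      hasMFDerivAt_iff_hasFDerivAt.mpr hG.hasFDerivAt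
    convert h2.comp x (hv.sub hU).hasMFDerivAt using 1
    ext z
    exact mul_comm (v x - U x) ((mfderiv (𝓡 3) 𝓘(ℝ, ℝ) (v - U) x) z)
  have hsum := hU.hasMFDerivAt.add hcomp
  have hfun : (fun y ↦ U y + (v y - U y) ^ 2 / 2) = U + (fun ρ : ℝ ↦ ρ ^ 2 / 2) ∘ (v - U) := rfl
  have hsub : (mfderiv (𝓡 3) 𝓘(ℝ, ℝ) (v - U) x : TangentSpace (𝓡 3) x →L[ℝ] ℝ) =
      (by exact mfderiv (𝓡 3) 𝓘(ℝ, ℝ) v x) - (by exact mfderiv (𝓡 3) 𝓘(ℝ, ℝ) U x) := mfderiv_sub hv hU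
  have hpt : ∀ z, mvfderiv (𝓡 3) (fun y ↦ U y + (v y - U y) ^ 2 / 2) x z =
      (1 - (v x - U x)) * mvfderiv (𝓡 3) U x z + (v x - U x) * mvfderiv (𝓡 3) v x z := by
    intro z
    have eU : ((by exact mfderiv (𝓡 3) 𝓘(ℝ, ℝ) U x : TangentSpace (𝓡 3) x →L[ℝ] ℝ)) z =
        mvfderiv (𝓡 3) U x z := rfl
    have ev : ((by exact mfderiv (𝓡 3) 𝓘(ℝ, ℝ) v x : TangentSpace (𝓡 3) x →L[ℝ] ℝ)) z =
        mvfderiv (𝓡 3) v x z := rfl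
    rw [show mvfderiv (𝓡 3) (fun y ↦ U y + (v y - U y) ^ 2 / 2) x z =
      ((by exact mfderiv (𝓡 3) 𝓘(ℝ, ℝ) (fun y ↦ U y + (v y - U y) ^ 2 / 2) x :
        TangentSpace (𝓡 3) x →L[ℝ] ℝ)) z from rfl]
    rw [hfun, hsum.mfderiv, add_apply, smul_apply, hsub, sub_apply, smul_eq_mul, eU, ev]
    ring
  have := gradNorm_le_of_mvfderiv_eq h (1 - (v x - U x)) (v x - U x) hpt
  rwa [abs_of_nonneg (by linarith), abs_of_nonneg h0] at this

end Slope

/-! ### The calibrated gap estimate: `|∇u| = |∇v| = 0` a.e. on `{v > u}` -/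

section Gap

variable (h : ContMDiffRiemannianMetric (𝓡 3) ∞ E3 (TangentSpace (𝓡 3) : X → Type _))
  [T2Space X] [LocallyCompactSpace X] [MeasurableSpace X] [BorelSpace X]
  [SecondCountableTopology X]

omit [MeasurableSpace X] [BorelSpace X] [SecondCountableTopology X] in
/-- **Products of locally Lipschitz functions are locally Lipschitz** (both factors are locally
bounded): `|fg(y) - fg(z)| ≤ |f y| |g y - g z| + |g z| |f y - f z|`. [folklore] -/
theorem IsLocLipschitzOn.mul {f g : X → ℝ} {Ω : Set X} (hf : IsLocLipschitzOn h f Ω)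
    (hg : IsLocLipschitzOn h g Ω) : IsLocLipschitzOn h (fun x ↦ f x * g x) Ω := by
  letI : RiemannianBundle (fun x : X ↦ TangentSpace (𝓡 3) x) :=
    ⟨h.toContinuousRiemannianMetric.toRiemannianMetric⟩
  letI : PseudoEMetricSpace X := .ofRiemannianMetric (𝓡 3) X
  have hfc : ContinuousOn f Ω := hf.continuousOn h
  have hgc : ContinuousOn g Ω := hg.continuousOn h
  intro x hx
  obtain ⟨Kf, tf, htf, hKf⟩ := (show LocallyLipschitzOn Ω f from hf) hx
  obtain ⟨Kg, tg, htg, hKg⟩ := (show LocallyLipschitzOn Ω g from hg) hx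
  have hsf : f ⁻¹' Metric.ball (f x) 1 ∈ 𝓝[Ω] x :=
    (hfc x hx).preimage_mem_nhdsWithin (Metric.ball_mem_nhds _ one_pos)
  have hsg : g ⁻¹' Metric.ball (g x) 1 ∈ 𝓝[Ω] x :=
    (hgc x hx).preimage_mem_nhdsWithin (Metric.ball_mem_nhds _ one_pos)
  refine ⟨(‖f x‖₊ + 1) * Kg + (‖g x‖₊ + 1) * Kf,
    (tf ∩ tg) ∩ (f ⁻¹' Metric.ball (f x) 1 ∩ g ⁻¹' Metric.ball (g x) 1),
    inter_mem (inter_mem htf htg) (inter_mem hsf hsg), ?_⟩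
  intro y hy z hz
  have hfy : ‖f y‖ₑ ≤ ((‖f x‖₊ + 1 : ℝ≥0) : ℝ≥0∞) := by
    rw [enorm_eq_nnnorm, ENNReal.coe_le_coe, ← NNReal.coe_le_coe]
    push_cast
    have : dist (f y) (f x) < 1 := hy.2.1
    rw [Real.dist_eq] at this
    have h1 := abs_sub_abs_le_abs_sub (f y) (f x)
    simp only [Real.norm_eq_abs]
    linarith
  have hgz : ‖g z‖ₑ ≤ ((‖g x‖₊ + 1 : ℝ≥0) : ℝ≥0∞) := by
    rw [enorm_eq_nnnorm, ENNReal.coe_le_coe, ← NNReal.coe_le_coe]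
    push_cast
    have : dist (g z) (g x) < 1 := hz.2.2
    rw [Real.dist_eq] at this
    have h1 := abs_sub_abs_le_abs_sub (g z) (g x)
    simp only [Real.norm_eq_abs]
    linarith
  calc edist (f y * g y) (f z * g z)
      ≤ edist (f y * g y) (f y * g z) + edist (f y * g z) (f z * g z) := edist_triangle _ _ _
    _ = ‖f y‖ₑ * edist (g y) (g z) + ‖g z‖ₑ * edist (f y) (f z) := by
        rw [edist_eq_enorm_sub, edist_eq_enorm_sub, edist_eq_enorm_sub (f y), edist_eq_enorm_sub (g y),
          ← mul_sub, ← sub_mul, enorm_mul, enorm_mul, mul_comm ‖f y - f z‖ₑ]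
    _ ≤ ((‖f x‖₊ + 1 : ℝ≥0) : ℝ≥0∞) * (Kg * edist y z) +
          ((‖g x‖₊ + 1 : ℝ≥0) : ℝ≥0∞) * (Kf * edist y z) := by
        gcongr
        · exact hKg hy.1.2 hz.1.2
        · exact hKf hy.1.1 hz.1.1
    _ = (((‖f x‖₊ + 1) * Kg + (‖g x‖₊ + 1) * Kf : ℝ≥0) : ℝ≥0∞) * edist y z := by
        push_cast
        ring

/-- **The gap estimate of Huisken–Ilmanen's Uniqueness Theorem** (proof of Thm. 2.2 (i), from
(2.2) to "`|∇u| = 0` a.e. on `{v > u}`, and then (2.3) implies that `|∇v| = 0` a.e. on `{v > u}`").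
Let `U` be locally Lipschitz on the open set `Ω` and a *strict* weak supersolution in the sense of
(2.2): `J_U^K(U) + ε ∫_K (w - U)|∇U| ≤ J_U^K(w)` for competitors `w ≥ U`; let `v` be a weak
subsolution on `Ω` with `{v > U} ∩ Ω` inside a compact `C ⊆ Ω` and `v ≤ U + ε` on `Ω`
(`0 < ε ≤ 1`). Then `|∇U| = 0` and `|∇v| = 0` at `μ_h`-a.e. point of `{v > U} ∩ Ω`.

Proof (functional transcription of pp. 23–24 of the source). With `R = (v - U)₊`:
(2.2) for `w = max(v, U) = U + R` and (1.5) for `v` against `min(v, U) = v - R` add up — using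
`|∇max(v,U)| + |∇min(v,U)| = |∇v| + |∇U|` a.e. — to (2.4): `ε ∫ R|∇U| ≤ ∫ R (|∇U| - |∇v|)`.
Huisken–Ilmanen then insert the family `u + (v - s - u)₊`, `s ≥ 0`, and integrate over `s`; since
`∫₀^∞ (r - s)₊ ds = r₊²/2`, this amounts to the single competitor `w₂ = U + R²/2`, whose slope
satisfies `|∇w₂| ≤ |∇U| + R(|∇v| - |∇U|)` a.e. (`dw₂ = (1 - R) dU + R dv` on `{v > U}`), giving
`∫ R (|∇U| - |∇v|) ≤ ∫ (R²/2) |∇U| ≤ (ε/2) ∫ R |∇U|`. Hence `∫ R|∇U| = 0`, i.e. `|∇U| = 0` a.e. on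
`{v > U}`, and then the subsolution inequality forces `|∇v|(1 + R) = 0` a.e. there.
[cite: HuiskenIlmanenIMCF2001, proof of Thm. 2.2 (i), (2.2)–(2.4)] -/
theorem ae_gradNorm_eq_zero_of_strictSupersolution {U v : X → ℝ} {Ω C : Set X} {ε : ℝ}
    (hΩ : IsOpen Ω) (hε : 0 < ε) (hε1 : ε ≤ 1) (hUl : IsLocLipschitzOn h U Ω)
    (hstrict : ∀ w, IsCompetitor h U Ω w → (∀ x ∈ Ω, U x ≤ w x) →
      ∀ K, IsCompact K → K ⊆ Ω → {x | x ∈ Ω ∧ w x ≠ U x} ⊆ K →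
        imcfEnergy h U K U + ε * ∫ x in K, (w x - U x) * gradNorm h U x ∂riemannianMeasure h ≤
          imcfEnergy h U K w)
    (hv : IsWeakSubsolution h v Ω) (hC : IsCompact C) (hCΩ : C ⊆ Ω)
    (hUv : {x | x ∈ Ω ∧ U x < v x} ⊆ C) (hvε : ∀ x ∈ Ω, v x ≤ U x + ε) :
    (∀ᵐ x ∂riemannianMeasure h, x ∈ Ω → U x < v x → gradNorm h U x = 0) ∧
      (∀ᵐ x ∂riemannianMeasure h, x ∈ Ω → U x < v x → gradNorm h v x = 0) := by
  have hvl := hv.1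
  have hCm : MeasurableSet C := hC.measurableSet
  -- the gap `R = (v - U)₊` and the three competitors
  have hRl : IsLocLipschitzOn h (fun x ↦ max (v x - U x) 0) Ω := (hvl.sub h hUl).posPart h
  have hR0 : ∀ x, 0 ≤ max (v x - U x) 0 := fun x ↦ le_max_right _ _
  have hRε : ∀ x ∈ Ω, max (v x - U x) 0 ≤ ε := fun x hx ↦
    max_le (by linarith [hvε x hx]) hε.le
  have hRpos : ∀ x, U x < v x → 0 < max (v x - U x) 0 := fun x hx ↦
    lt_max_of_lt_left (sub_pos.2 hx)
  have hRzero : ∀ x, ¬ U x < v x → max (v x - U x) 0 = 0 := fun x hx ↦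
    max_eq_right (by linarith [not_lt.1 hx])
  have hwl : IsLocLipschitzOn h (fun x ↦ max (v x) (U x)) Ω := hvl.sup h hUl
  have hml : IsLocLipschitzOn h (fun x ↦ min (v x) (U x)) Ω := hvl.inf h hUl
  have hw₂l : IsLocLipschitzOn h (fun x ↦ U x + (max (v x - U x) 0) ^ 2 / 2) Ω := by
    have h1 : IsLocLipschitzOn h (fun x ↦ (max (v x - U x) 0) ^ 2 / 2) Ω := by
      have h3 := (hRl.mul h hRl).const_mul h (1 / 2 : ℝ)
      have h4 : (fun x ↦ (max (v x - U x) 0) ^ 2 / 2) =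
          fun x ↦ 1 / 2 * (max (v x - U x) 0 * max (v x - U x) 0) := by
        funext x; ring
      rw [h4]
      exact h3
    exact hUl.add h h1
  -- exceptional sets and order relations of the competitors
  have hwU : ∀ x, max (v x) (U x) - U x = max (v x - U x) 0 := fun x ↦ by
    rw [← max_sub_sub_right, sub_self]
  have hmv : ∀ x, min (v x) (U x) - v x = -max (v x - U x) 0 := fun x ↦ by
    rcases le_total (v x) (U x) with hle | hle
    · rw [min_eq_left hle, max_eq_right (by linarith), sub_self, neg_zero]
    · rw [min_eq_right hle, max_eq_left (by linarith)]; ring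
  have hwC : {x | x ∈ Ω ∧ max (v x) (U x) ≠ U x} ⊆ C := fun x hx ↦
    hUv ⟨hx.1, by by_contra hle; exact hx.2 (max_eq_right (not_lt.1 hle))⟩
  have hmC : {x | x ∈ Ω ∧ min (v x) (U x) ≠ v x} ⊆ C := fun x hx ↦
    hUv ⟨hx.1, by by_contra hle; exact hx.2 (min_eq_left (not_lt.1 hle))⟩
  have hw₂C : {x | x ∈ Ω ∧ U x + (max (v x - U x) 0) ^ 2 / 2 ≠ U x} ⊆ C := fun x hx ↦
    hUv ⟨hx.1, by by_contra hle; exact hx.2 (by rw [hRzero x hle]; ring)⟩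
  have hwge : ∀ x ∈ Ω, U x ≤ max (v x) (U x) := fun x _ ↦ le_max_right _ _
  have hmle : ∀ x ∈ Ω, min (v x) (U x) ≤ v x := fun x _ ↦ min_le_left _ _
  have hw₂ge : ∀ x ∈ Ω, U x ≤ U x + (max (v x - U x) 0) ^ 2 / 2 := fun x _ ↦ by
    have := sq_nonneg (max (v x - U x) 0); linarith
  -- the three energy inequalities (2.2) for `w`, (1.5) for `v` against `m`, (1.5) for `U` against `w₂`
  have hI := hstrict _ ⟨hwl, C, hC, hCΩ, hwC⟩ hwge C hC hCΩ hwC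
  have hII := hv.2 _ ⟨hml, C, hC, hCΩ, hmC⟩ hmle C hC hCΩ hmC
  have hIV : imcfEnergy h U C U ≤ imcfEnergy h U C (fun x ↦ U x + (max (v x - U x) 0) ^ 2 / 2) := by
    have h1 := hstrict _ ⟨hw₂l, C, hC, hCΩ, hw₂C⟩ hw₂ge C hC hCΩ hw₂C
    have h2 : 0 ≤ ε * ∫ x in C, (U x + (max (v x - U x) 0) ^ 2 / 2 - U x) * gradNorm h U x
        ∂riemannianMeasure h := by
      refine mul_nonneg hε.le (setIntegral_nonneg hCm fun x _ ↦ mul_nonneg ?_ (gradNorm_nonneg h U x))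
      have := sq_nonneg (max (v x - U x) 0); linarith
    linarith
  -- integrability on `C`
  have hcont : ∀ {f : X → ℝ}, IsLocLipschitzOn h f Ω → ContinuousOn f C :=
    fun hf ↦ (hf.continuousOn h).mono hCΩ
  have iU := hUl.integrableOn_gradNorm h hΩ hC hCΩ
  have iv := hvl.integrableOn_gradNorm h hΩ hC hCΩ
  have iRU : IntegrableOn (fun x ↦ max (v x - U x) 0 * gradNorm h U x) C (riemannianMeasure h) :=
    iU.continuousOn_mul (hcont hRl) hC
  have iRv : IntegrableOn (fun x ↦ max (v x - U x) 0 * gradNorm h v x) C (riemannianMeasure h) :=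
    iv.continuousOn_mul (hcont hRl) hC
  have iR2U : IntegrableOn (fun x ↦ (max (v x - U x) 0) ^ 2 / 2 * gradNorm h U x) C
      (riemannianMeasure h) :=
    iU.continuousOn_mul ((hcont hRl).pow 2 |>.div_const 2) hC
  have iIU := integrableOn_imcfEnergy_integrand h hUl hUl hΩ hC hCΩ
  have iIw := integrableOn_imcfEnergy_integrand h hUl hwl hΩ hC hCΩ
  have iIv := integrableOn_imcfEnergy_integrand h hvl hvl hΩ hC hCΩ
  have iIm := integrableOn_imcfEnergy_integrand h hvl hml hΩ hC hCΩ
  have iIw₂ := integrableOn_imcfEnergy_integrand h hUl hw₂l hΩ hC hCΩ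
  -- (2.4): `ε ∫ R|∇U| ≤ ∫ R (|∇U| - |∇v|)`
  have h24 : ε * ∫ x in C, max (v x - U x) 0 * gradNorm h U x ∂riemannianMeasure h ≤
      ∫ x in C, max (v x - U x) 0 * gradNorm h U x ∂riemannianMeasure h -
        ∫ x in C, max (v x - U x) 0 * gradNorm h v x ∂riemannianMeasure h := by
    -- rewrite the `ε`-term of (2.2)
    have h1 : ∫ x in C, (max (v x) (U x) - U x) * gradNorm h U x ∂riemannianMeasure h =
        ∫ x in C, max (v x - U x) 0 * gradNorm h U x ∂riemannianMeasure h :=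
      integral_congr_ae (Eventually.of_forall fun x ↦ by simp only [hwU])
    rw [h1] at hI
    -- the sum of the two energy differences is `∫ R (|∇U| - |∇v|)`
    have h2 : imcfEnergy h U C (fun x ↦ max (v x) (U x)) - imcfEnergy h U C U +
        (imcfEnergy h v C (fun x ↦ min (v x) (U x)) - imcfEnergy h v C v) =
        ∫ x in C, max (v x - U x) 0 * gradNorm h U x ∂riemannianMeasure h -
          ∫ x in C, max (v x - U x) 0 * gradNorm h v x ∂riemannianMeasure h := by
      unfold imcfEnergy
      have i1 : IntegrableOn (fun x ↦ gradNorm h (fun x ↦ max (v x) (U x)) x + max (v x) (U x) * gradNorm h U x -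
          (gradNorm h U x + U x * gradNorm h U x)) C (riemannianMeasure h) := iIw.sub iIU
      have i2 : IntegrableOn (fun x ↦ gradNorm h (fun x ↦ min (v x) (U x)) x + min (v x) (U x) * gradNorm h v x -
          (gradNorm h v x + v x * gradNorm h v x)) C (riemannianMeasure h) := iIm.sub iIv
      rw [← integral_sub iIw iIU, ← integral_sub iIm iIv, ← integral_add i1 i2, ← integral_sub iRU iRv]
      refine integral_congr_ae ((ae_restrict_iff' hCm).2 ?_)
      filter_upwards [hvl.ae_gradNorm_sup_add_gradNorm_inf h hUl hΩ] with x hx hxC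
      have h3 := hx (hCΩ hxC)
      have h4 := hwU x
      have h5 := hmv x
      -- the integrand identity
      calc gradNorm h (fun x ↦ max (v x) (U x)) x + max (v x) (U x) * gradNorm h U x -
            (gradNorm h U x + U x * gradNorm h U x) +
            (gradNorm h (fun x ↦ min (v x) (U x)) x + min (v x) (U x) * gradNorm h v x -
              (gradNorm h v x + v x * gradNorm h v x))
          = (gradNorm h (fun x ↦ max (v x) (U x)) x + gradNorm h (fun x ↦ min (v x) (U x)) x -
              (gradNorm h v x + gradNorm h U x)) +
            (max (v x) (U x) - U x) * gradNorm h U x +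
            (min (v x) (U x) - v x) * gradNorm h v x := by ring
        _ = max (v x - U x) 0 * gradNorm h U x - max (v x - U x) 0 * gradNorm h v x := by
            rw [h3, h4, h5]; ring
    linarith
  -- (IV): `∫ R (|∇U| - |∇v|) ≤ ∫ (R²/2) |∇U|`, from the calibrated competitor `w₂`
  have hIV' : ∫ x in C, max (v x - U x) 0 * gradNorm h U x ∂riemannianMeasure h -
      ∫ x in C, max (v x - U x) 0 * gradNorm h v x ∂riemannianMeasure h ≤
      ∫ x in C, (max (v x - U x) 0) ^ 2 / 2 * gradNorm h U x ∂riemannianMeasure h := by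
    -- `0 ≤ J_U(w₂) - J_U(U) = ∫ (|∇w₂| - |∇U|) + (R²/2)|∇U| ≤ ∫ R(|∇v| - |∇U|) + (R²/2)|∇U|`
    have h1 : imcfEnergy h U C (fun x ↦ U x + (max (v x - U x) 0) ^ 2 / 2) - imcfEnergy h U C U ≤
        (∫ x in C, max (v x - U x) 0 * gradNorm h v x ∂riemannianMeasure h -
          ∫ x in C, max (v x - U x) 0 * gradNorm h U x ∂riemannianMeasure h) +
          ∫ x in C, (max (v x - U x) 0) ^ 2 / 2 * gradNorm h U x ∂riemannianMeasure h := by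
      unfold imcfEnergy
      have i3 : IntegrableOn (fun x ↦ max (v x - U x) 0 * gradNorm h v x - max (v x - U x) 0 * gradNorm h U x)
          C (riemannianMeasure h) := iRv.sub iRU
      have i4 : IntegrableOn (fun x ↦ gradNorm h (fun x ↦ U x + (max (v x - U x) 0) ^ 2 / 2) x +
          (U x + (max (v x - U x) 0) ^ 2 / 2) * gradNorm h U x - (gradNorm h U x + U x * gradNorm h U x))
          C (riemannianMeasure h) := iIw₂.sub iIU
      rw [← integral_sub iIw₂ iIU, ← integral_sub iRv iRU, ← integral_add i3 iR2U]
      refine integral_mono_ae i4 (i3.add iR2U) ((ae_restrict_iff' hCm).2 ?_)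
      filter_upwards [hw₂l.ae_gradNorm_eq_of_eq h hUl hΩ, hUl.ae_mdifferentiableAt h hΩ,
        hvl.ae_mdifferentiableAt h hΩ] with x h2 h3 h4 hxC
      have hxΩ := hCΩ hxC
      have hUc : ContinuousAt U x := (hUl.continuousOn h).continuousAt (hΩ.mem_nhds hxΩ)
      have hvc : ContinuousAt v x := (hvl.continuousOn h).continuousAt (hΩ.mem_nhds hxΩ)
      -- the slope bound `|∇w₂| ≤ |∇U| + R (|∇v| - |∇U|)` at `x`
      have hslope : gradNorm h (fun x ↦ U x + (max (v x - U x) 0) ^ 2 / 2) x ≤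
          gradNorm h U x + max (v x - U x) 0 * (gradNorm h v x - gradNorm h U x) := by
        by_cases hlt : U x < v x
        · have hev : (fun y ↦ U y + (max (v y - U y) 0) ^ 2 / 2) =ᶠ[𝓝 x]
              fun y ↦ U y + (v y - U y) ^ 2 / 2 := by
            filter_upwards [hUc.eventually_lt hvc hlt] with y hy
            rw [max_eq_left (sub_pos.2 hy).le]
          have hb := gradNorm_add_sq_div_two_le h (h3 hxΩ) (h4 hxΩ) hev (sub_pos.2 hlt).le
            (by linarith [hvε x hxΩ])
          rw [max_eq_left (sub_pos.2 hlt).le]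
          linarith
        · have h5 : gradNorm h (fun x ↦ U x + (max (v x - U x) 0) ^ 2 / 2) x = gradNorm h U x :=
            h2 hxΩ (by show U x + (max (v x - U x) 0) ^ 2 / 2 = U x; rw [hRzero x hlt]; ring)
          rw [h5, hRzero x hlt]
          linarith
      linarith
    linarith
  -- `∫ (R²/2)|∇U| ≤ (ε/2) ∫ R|∇U|`
  have hsmall : ∫ x in C, (max (v x - U x) 0) ^ 2 / 2 * gradNorm h U x ∂riemannianMeasure h ≤
      ε / 2 * ∫ x in C, max (v x - U x) 0 * gradNorm h U x ∂riemannianMeasure h := by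
    rw [← integral_const_mul]
    refine setIntegral_mono_on iR2U (iRU.const_mul _) hCm fun x hx ↦ ?_
    have h1 := hRε x (hCΩ hx)
    have h2 := hR0 x
    have h3 := gradNorm_nonneg h U x
    calc (max (v x - U x) 0) ^ 2 / 2 * gradNorm h U x
        = max (v x - U x) 0 / 2 * (max (v x - U x) 0 * gradNorm h U x) := by ring
      _ ≤ ε / 2 * (max (v x - U x) 0 * gradNorm h U x) := by gcongr
  -- hence `∫ R|∇U| = 0`
  have hint0 : ∫ x in C, max (v x - U x) 0 * gradNorm h U x ∂riemannianMeasure h = 0 := by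
    have h1 : 0 ≤ ∫ x in C, max (v x - U x) 0 * gradNorm h U x ∂riemannianMeasure h :=
      setIntegral_nonneg hCm fun x _ ↦ mul_nonneg (hR0 x) (gradNorm_nonneg h U x)
    nlinarith
  have haeU : ∀ᵐ x ∂riemannianMeasure h, x ∈ Ω → U x < v x → gradNorm h U x = 0 := by
    have h1 := (integral_eq_zero_iff_of_nonneg_ae ((ae_restrict_iff' hCm).2
      (Eventually.of_forall fun x _ ↦ mul_nonneg (hR0 x) (gradNorm_nonneg h U x))) iRU).1 hint0
    have h2 : ∀ᵐ x ∂riemannianMeasure h, x ∈ C → max (v x - U x) 0 * gradNorm h U x = 0 :=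
      (ae_restrict_iff' hCm).1 h1
    filter_upwards [h2] with x hx hxΩ hlt
    have h3 := hx (hUv ⟨hxΩ, hlt⟩)
    exact (mul_eq_zero.1 h3).resolve_left (hRpos x hlt).ne'
  refine ⟨haeU, ?_⟩
  -- finally `|∇v| = 0` a.e. on `{v > U}`, from the subsolution inequality (2.3)
  have hφ : ∫ x in C, (gradNorm h (fun x ↦ min (v x) (U x)) x + min (v x) (U x) * gradNorm h v x -
      (gradNorm h v x + v x * gradNorm h v x)) ∂riemannianMeasure h =
      imcfEnergy h v C (fun x ↦ min (v x) (U x)) - imcfEnergy h v C v := by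
    unfold imcfEnergy; rw [integral_sub iIm iIv]
  have hφle : ∀ᵐ x ∂(riemannianMeasure h).restrict C,
      gradNorm h (fun x ↦ min (v x) (U x)) x + min (v x) (U x) * gradNorm h v x -
        (gradNorm h v x + v x * gradNorm h v x) ≤ 0 := by
    refine (ae_restrict_iff' hCm).2 ?_
    filter_upwards [hml.ae_gradNorm_eq_of_eq h hvl hΩ, haeU] with x h1 h2 hxC
    have hxΩ := hCΩ hxC
    by_cases hlt : U x < v x
    · have hUc : ContinuousAt U x := (hUl.continuousOn h).continuousAt (hΩ.mem_nhds hxΩ)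
      have hvc : ContinuousAt v x := (hvl.continuousOn h).continuousAt (hΩ.mem_nhds hxΩ)
      rw [gradNorm_inf_of_gt h hvc hUc hlt, h2 hxΩ hlt, min_eq_right hlt.le]
      nlinarith [gradNorm_nonneg h v x, sub_pos.2 hlt]
    · rw [h1 hxΩ (min_eq_left (not_lt.1 hlt)), min_eq_left (not_lt.1 hlt)]
      exact (sub_self _).le
  have hφ0 : (fun x ↦ gradNorm h (fun x ↦ min (v x) (U x)) x + min (v x) (U x) * gradNorm h v x -
      (gradNorm h v x + v x * gradNorm h v x)) =ᵐ[(riemannianMeasure h).restrict C] 0 := by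
    have hint : 0 ≤ ∫ x in C, (gradNorm h (fun x ↦ min (v x) (U x)) x +
        min (v x) (U x) * gradNorm h v x - (gradNorm h v x + v x * gradNorm h v x))
        ∂riemannianMeasure h := by rw [hφ]; linarith
    have hneg := (integral_eq_zero_iff_of_nonneg_ae (f := fun x ↦ -(gradNorm h
        (fun x ↦ min (v x) (U x)) x + min (v x) (U x) * gradNorm h v x -
        (gradNorm h v x + v x * gradNorm h v x)))
      (hφle.mono fun x hx ↦ by simpa using hx) (iIm.sub iIv).neg).1 (by
        rw [integral_neg]
        have := integral_nonpos_of_ae hφle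
        linarith)
    filter_upwards [hneg] with x hx
    simpa only [Pi.zero_apply, neg_eq_zero] using hx
  have h3 : ∀ᵐ x ∂riemannianMeasure h, x ∈ C →
      gradNorm h (fun x ↦ min (v x) (U x)) x + min (v x) (U x) * gradNorm h v x -
        (gradNorm h v x + v x * gradNorm h v x) = 0 := (ae_restrict_iff' hCm).1 hφ0
  filter_upwards [h3, haeU] with x hx h2 hxΩ hlt
  have hUc : ContinuousAt U x := (hUl.continuousOn h).continuousAt (hΩ.mem_nhds hxΩ)
  have hvc : ContinuousAt v x := (hvl.continuousOn h).continuousAt (hΩ.mem_nhds hxΩ)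
  have h4 := hx (hUv ⟨hxΩ, hlt⟩)
  rw [gradNorm_inf_of_gt h hvc hUc hlt, h2 hxΩ hlt, min_eq_right hlt.le] at h4
  -- `h4 : 0 + U|∇v| - (|∇v| + v|∇v|) = 0`, i.e. `|∇v| (1 + (v - U)) = 0`
  have h5 : gradNorm h v x * (1 + (v x - U x)) = 0 := by linarith
  exact (mul_eq_zero.1 h5).resolve_right (by linarith)

end Gap

end Literature.Geometry.Lorentzian

end
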